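import Summits.Ventures.HSemireg.ContractionSpanKunnethRank
import HarnessLib

/-!
# Venture HSemireg — Künneth structure of the polyvector contraction span, IV: transport from the factor's own
# exterior algebra and the POINT-PAIR BOX `r(ch(I_p ⊠ I_q)) = 2·r₂(n) + r₁(n)² = 6n² - 2n` (`18` at `n = 2`)

HONEST FRAMING. Pure linear algebra, continuing `ContractionSpanKunnethRank.lean` (seat p4 of the computation cell
`pub-hsemireg`; statement sheet `theory/FORMULA-N-th7.md` §N.3 / §N.5, theory seat 7). Nothing here is a claim about any
variety and nothing here says that HC / HC_CM / HC_AV holds. Everything is PROVED; no named fact.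

CONTENT. §1 TRANSPORT («the block-embedding glue» of th-7 §N.7): along the injective algebra map
`Λ V₁ → Λ V` induced by `V₁ ↪ V = V₁ ⊕ V₂`, interior products are natural (`contractLeft_map`), degrees are preserved,
EVEN elements land in `evenFactorAlg V₁`, and the factor's three contraction spans computed INSIDE `Λ V` (with respect to
`L₁` and `factorForms L₁ V₂`) are the images of the INTRINSIC spans in `Λ V₁` (with respect to `L₁` and `L₁^⊥ ⊆ V₁^*`) — so
their dimensions are the intrinsic ones (`finrank_span_map_eq`, `finrank_span₁_map_eq`). §2 For a POINT-IDEAL factor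
`x = a·1 + b·ω`, `ω ≠ 0` a top form of `V₁` (`dim V₁ = 2n`, `dim L₁ = n`): the three spans sit in degrees
`{2, 2n-2} / {1, 2n-1} / {0, 2n}` and are therefore INDEPENDENT for `n ≥ 2` (`iSupIndep_three_of_le_exteriorPower`), with
dimensions `2·C(n,2)` (`1` if `n = 2`) / `2n` / `1` (T_lin and its degree-one sibling, transported). §3 THE BOX: for two
such factors of the same `n`, `dim span((a₁ + b₁ω₁) ∧ (a₂ + b₂ω₂)) = 2·(2·C(n,2)) + (2n)²` for `n ≥ 3`
(`finrank_span_pointPairBox`, `= 6n² - 2n`: `finrank_span_pointPairBox'`) and `= 1 + 16 + 1 = 18` for `n = 2`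
(`finrank_span_pointPairBox_two`) — th-7's `[t²]P_n²`, i.e. the census' `r = 18` (g = 4) and `r = 48` (g = 6) as theorems
of the class SHAPE. The real-carrier corollary (`contractionRank` of an abelian variety whose `H¹`, `H^{0,1}` and total
class split this way) is the sequel `ContractionRankPointPairBox.lean`.

References: [BourbakiAlgebre1a3] Ch. III §7 no. 1–2 (functoriality of `Λ`), no. 7 (`Λ(M ⊕ N)`), §11 no. 9;
[BuchweitzFlenner2008HH] Prop. 6.4.4.
-/

noncomputable section

open CliffordAlgebra (contractLeft)
open ExteriorAlgebra (ι)
open Module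

namespace Summit.Ventures.HSemireg

namespace ContractionSpan

/-! ### 1. Transport along `Λ W → Λ V` -/

section Transport

variable {K : Type*} [Field K] {V : Type*} [AddCommGroup V] [Module K V] {W : Type*} [AddCommGroup W] [Module K W]

/-- **Interior products are natural**: `ι_θ (Λg y) = Λg (ι_{θ ∘ g} y)` for linear `g : W → V`. [cite: BourbakiAlgebre1a3, Ch. III §11 no. 9] -/
theorem contractLeft_map (g : W →ₗ[K] V) (θ : Module.Dual K V) (y : ExteriorAlgebra K W) :
    contractLeft θ (ExteriorAlgebra.map g y) = ExteriorAlgebra.map g (contractLeft (θ ∘ₗ g) y) := by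
  induction y using CliffordAlgebra.left_induction with
  | algebraMap r =>
    rw [AlgHom.commutes, CliffordAlgebra.contractLeft_algebraMap, CliffordAlgebra.contractLeft_algebraMap, map_zero]
  | add x y hx hy => rw [map_add, map_add, hx, hy, map_add, map_add]
  | ι_mul x m hx =>
    rw [map_mul, ExteriorAlgebra.map_apply_ι, CliffordAlgebra.contractLeft_ι_mul, CliffordAlgebra.contractLeft_ι_mul, hx,
      map_sub, map_smul, map_mul, ExteriorAlgebra.map_apply_ι, LinearMap.comp_apply]

/-- `Λg` preserves degrees: `Λg (Λᵏ W) ⊆ Λᵏ V`. [cite: BourbakiAlgebre1a3, Ch. III §7 no. 2] -/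
theorem map_mem_exteriorPower (g : W →ₗ[K] V) {k : ℕ} {y : ExteriorAlgebra K W} (hy : y ∈ ⋀[K]^k W) :
    ExteriorAlgebra.map g y ∈ ⋀[K]^k V := by
  have hle : (⋀[K]^k W).map (ExteriorAlgebra.map g).toLinearMap ≤ ⋀[K]^k V := by
    rw [← ExteriorAlgebra.ιMulti_span_fixedDegree, Submodule.map_span, Submodule.span_le]
    rintro _ ⟨_, ⟨w, rfl⟩, rfl⟩
    rw [SetLike.mem_coe, AlgHom.toLinearMap_apply, ExteriorAlgebra.map_apply_ιMulti]
    exact ExteriorAlgebra.ιMulti_range K k ⟨_, rfl⟩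
  exact hle ⟨y, hy, rfl⟩

/-- `Λg` sends EVEN-degree elements into `Λ^{even}(g(W))`. [cite: BourbakiAlgebre1a3, Ch. III §7 no. 2] -/
theorem map_mem_evenFactorAlg (g : W →ₗ[K] V) {m : ℕ} {y : ExteriorAlgebra K W} (hy : y ∈ ⋀[K]^(2 * m) W) :
    ExteriorAlgebra.map g y ∈ evenFactorAlg (LinearMap.range g) := by
  rw [show (⋀[K]^(2 * m) W) = (⋀[K]^2 W) ^ m from pow_mul _ 2 m] at hy
  induction hy using Submodule.pow_induction_on_left' with
  | algebraMap r => rw [AlgHom.commutes]; exact Subalgebra.algebraMap_mem _ r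
  | add x y i _ _ ihx ihy => rw [map_add]; exact Subalgebra.add_mem _ ihx ihy
  | mem_mul p hp i x _ ih =>
    rw [map_mul]
    refine Subalgebra.mul_mem _ ?_ ih
    have hp' : p ∈ LinearMap.range (ι K (M := W)) * LinearMap.range (ι K (M := W)) := by
      rw [← pow_two]; exact hp
    refine Submodule.mul_induction_on hp' (fun a ha c hc => ?_)
      (fun a c ha hc => by rw [map_add]; exact Subalgebra.add_mem _ ha hc)
    obtain ⟨v, rfl⟩ := LinearMap.mem_range.mp ha
    obtain ⟨w, rfl⟩ := LinearMap.mem_range.mp hc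
    rw [map_mul, ExteriorAlgebra.map_apply_ι, ExteriorAlgebra.map_apply_ι]
    exact ι_mul_ι_mem_evenFactorAlg (LinearMap.mem_range_self g v) (LinearMap.mem_range_self g w)

variable {V₁ V₂ L₁ : Submodule K V}

/-- Extension by zero of a form on `V₁` killing `L₁ ∩ V₁` is a factor form. [cite: BourbakiAlgebre1a3, Ch. II §1 no. 8] -/
theorem comp_projectionOnto_mem_factorForms (hV : IsCompl V₁ V₂) (hL₁ : L₁ ≤ V₁) {θ' : Module.Dual K V₁}
    (hθ' : ∀ q ∈ L₁.comap V₁.subtype, θ' q = 0) : θ' ∘ₗ V₁.projectionOnto V₂ hV ∈ factorForms L₁ V₂ :=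
  ⟨fun q hq => by
    rw [LinearMap.comp_apply, Submodule.projectionOnto_apply_of_mem_left hV (hL₁ hq)]
    exact hθ' ⟨q, hL₁ hq⟩ hq,
   fun v hv => by rw [LinearMap.comp_apply, Submodule.projectionOnto_apply_of_mem_right hV hv, map_zero]⟩

/-- The extension restricts back to the form. [cite: BourbakiAlgebre1a3, Ch. II §1 no. 8] -/
theorem comp_projectionOnto_comp_subtype (hV : IsCompl V₁ V₂) (θ' : Module.Dual K V₁) :
    (θ' ∘ₗ V₁.projectionOnto V₂ hV) ∘ₗ V₁.subtype = θ' := by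
  ext q
  rw [LinearMap.comp_apply, LinearMap.comp_apply, Submodule.subtype_apply, Submodule.projectionOnto_apply_left]

/-- A factor form restricts to a form on `V₁` killing `L₁ ∩ V₁`. [cite: BourbakiAlgebre1a3, Ch. II §1 no. 8] -/
theorem comp_subtype_apply_eq_zero {θ : Module.Dual K V} (hθ : θ ∈ factorForms L₁ V₂) :
    ∀ q ∈ L₁.comap V₁.subtype, (θ ∘ₗ V₁.subtype) q = 0 := fun q hq => hθ.1 q hq

/-- **Transport of the degree-two span**: the factor's span computed inside `Λ V` is the image of its intrinsic span.
[cite: BourbakiAlgebre1a3, Ch. III §7 no. 1–2 and §11 no. 9] -/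
theorem span_map_eq (hV : IsCompl V₁ V₂) (hL₁ : L₁ ≤ V₁) (x' : ExteriorAlgebra K V₁) :
    span (L₁ : Set V) (factorForms L₁ V₂) (ExteriorAlgebra.map V₁.subtype x') =
      (span ((L₁.comap V₁.subtype : Submodule K V₁) : Set V₁)
        {θ' : Module.Dual K V₁ | ∀ q ∈ L₁.comap V₁.subtype, θ' q = 0} x').map (ExteriorAlgebra.map V₁.subtype).toLinearMap := by
  apply le_antisymm
  · refine Submodule.span_le.mpr ?_
    rintro y ((⟨q, hq, q', hq', rfl⟩ | ⟨q, hq, θ, hθ, rfl⟩) | ⟨θ, hθ, θ', hθ', rfl⟩)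
    · refine ⟨ι K ⟨q, hL₁ hq⟩ * (ι K ⟨q', hL₁ hq'⟩ * x'), Submodule.subset_span (Or.inl (Or.inl ⟨_, hq, _, hq', rfl⟩)), ?_⟩
      rw [AlgHom.toLinearMap_apply, map_mul, map_mul, ExteriorAlgebra.map_apply_ι, ExteriorAlgebra.map_apply_ι]
      rfl
    · refine ⟨ι K ⟨q, hL₁ hq⟩ * contractLeft (θ ∘ₗ V₁.subtype) x',
        Submodule.subset_span (Or.inl (Or.inr ⟨_, hq, _, comp_subtype_apply_eq_zero hθ, rfl⟩)), ?_⟩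
      rw [AlgHom.toLinearMap_apply, map_mul, ExteriorAlgebra.map_apply_ι, ← contractLeft_map]
      rfl
    · refine ⟨contractLeft (θ ∘ₗ V₁.subtype) (contractLeft (θ' ∘ₗ V₁.subtype) x'),
        Submodule.subset_span (Or.inr ⟨_, comp_subtype_apply_eq_zero hθ, _, comp_subtype_apply_eq_zero hθ', rfl⟩), ?_⟩
      rw [AlgHom.toLinearMap_apply, ← contractLeft_map, ← contractLeft_map]
  · rw [span, Submodule.map_span_le]
    rintro y ((⟨q, hq, q', hq', rfl⟩ | ⟨q, hq, θ', hθ', rfl⟩) | ⟨θ, hθ, θ', hθ', rfl⟩)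
    · rw [AlgHom.toLinearMap_apply, map_mul, map_mul, ExteriorAlgebra.map_apply_ι, ExteriorAlgebra.map_apply_ι]
      exact Submodule.subset_span (Or.inl (Or.inl ⟨_, hq, _, hq', rfl⟩))
    · rw [AlgHom.toLinearMap_apply, map_mul, ExteriorAlgebra.map_apply_ι, ← comp_projectionOnto_comp_subtype hV θ',
        ← contractLeft_map]
      exact Submodule.subset_span (Or.inl (Or.inr ⟨_, hq, _, comp_projectionOnto_mem_factorForms hV hL₁ hθ', rfl⟩))
    · rw [AlgHom.toLinearMap_apply, ← comp_projectionOnto_comp_subtype hV θ, ← comp_projectionOnto_comp_subtype hV θ',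
        ← contractLeft_map, ← contractLeft_map]
      exact Submodule.subset_span (Or.inr ⟨_, comp_projectionOnto_mem_factorForms hV hL₁ hθ, _,
        comp_projectionOnto_mem_factorForms hV hL₁ hθ', rfl⟩)

/-- **Transport of the degree-one span.** [cite: BourbakiAlgebre1a3, Ch. III §7 no. 1–2 and §11 no. 9] -/
theorem span₁_map_eq (hV : IsCompl V₁ V₂) (hL₁ : L₁ ≤ V₁) (x' : ExteriorAlgebra K V₁) :
    span₁ (L₁ : Set V) (factorForms L₁ V₂) (ExteriorAlgebra.map V₁.subtype x') =
      (span₁ ((L₁.comap V₁.subtype : Submodule K V₁) : Set V₁)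
        {θ' : Module.Dual K V₁ | ∀ q ∈ L₁.comap V₁.subtype, θ' q = 0} x').map (ExteriorAlgebra.map V₁.subtype).toLinearMap := by
  apply le_antisymm
  · refine Submodule.span_le.mpr ?_
    rintro y (⟨q, hq, rfl⟩ | ⟨θ, hθ, rfl⟩)
    · refine ⟨ι K ⟨q, hL₁ hq⟩ * x', Submodule.subset_span (Or.inl ⟨_, hq, rfl⟩), ?_⟩
      rw [AlgHom.toLinearMap_apply, map_mul, ExteriorAlgebra.map_apply_ι]
      rfl
    · refine ⟨contractLeft (θ ∘ₗ V₁.subtype) x', Submodule.subset_span (Or.inr ⟨_, comp_subtype_apply_eq_zero hθ, rfl⟩), ?_⟩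
      rw [AlgHom.toLinearMap_apply, ← contractLeft_map]
  · rw [span₁, Submodule.map_span_le]
    rintro y (⟨q, hq, rfl⟩ | ⟨θ', hθ', rfl⟩)
    · rw [AlgHom.toLinearMap_apply, map_mul, ExteriorAlgebra.map_apply_ι]
      exact Submodule.subset_span (Or.inl ⟨_, hq, rfl⟩)
    · rw [AlgHom.toLinearMap_apply, ← comp_projectionOnto_comp_subtype hV θ', ← contractLeft_map]
      exact Submodule.subset_span (Or.inr ⟨_, comp_projectionOnto_mem_factorForms hV hL₁ hθ', rfl⟩)

/-- Hence the dimension of the factor's degree-two span inside `Λ V` is the intrinsic one. [cite: BourbakiAlgebre1a3, Ch. III §7 no. 2] -/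
theorem finrank_span_map_eq (hV : IsCompl V₁ V₂) (hL₁ : L₁ ≤ V₁) (x' : ExteriorAlgebra K V₁) :
    Module.finrank K (span (L₁ : Set V) (factorForms L₁ V₂) (ExteriorAlgebra.map V₁.subtype x')) =
      Module.finrank K (span ((L₁.comap V₁.subtype : Submodule K V₁) : Set V₁)
        {θ' : Module.Dual K V₁ | ∀ q ∈ L₁.comap V₁.subtype, θ' q = 0} x') := by
  rw [span_map_eq hV hL₁]
  exact ((Submodule.equivMapOfInjective _
    (ExteriorAlgebra.map_injective_field (Submodule.ker_subtype V₁)) _).finrank_eq).symm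

/-- And of the degree-one span. [cite: BourbakiAlgebre1a3, Ch. III §7 no. 2] -/
theorem finrank_span₁_map_eq (hV : IsCompl V₁ V₂) (hL₁ : L₁ ≤ V₁) (x' : ExteriorAlgebra K V₁) :
    Module.finrank K (span₁ (L₁ : Set V) (factorForms L₁ V₂) (ExteriorAlgebra.map V₁.subtype x')) =
      Module.finrank K (span₁ ((L₁.comap V₁.subtype : Submodule K V₁) : Set V₁)
        {θ' : Module.Dual K V₁ | ∀ q ∈ L₁.comap V₁.subtype, θ' q = 0} x') := by
  rw [span₁_map_eq hV hL₁]
  exact ((Submodule.equivMapOfInjective _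
    (ExteriorAlgebra.map_injective_field (Submodule.ker_subtype V₁)) _).finrank_eq).symm

end Transport

/-! ### 2. A point-ideal factor inside `Λ V`: degrees, independence, dimensions -/

section Factor

variable {K : Type*} [Field K] {V : Type*} [AddCommGroup V] [Module K V]

/-- `a·1 + b·ω ≠ 0` for `a ≠ 0` and `ω` homogeneous of positive degree. [cite: BourbakiAlgebre1a3, Ch. III §7 no. 1] -/
theorem algebraMap_add_smul_ne_zero {a : K} (ha : a ≠ 0) (b : K) {d : ℕ} (hd : d ≠ 0) {ω : ExteriorAlgebra K V}
    (hω : ω ∈ ⋀[K]^d V) : algebraMap K (ExteriorAlgebra K V) a + b • ω ≠ 0 := by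
  intro h
  have h0 : algebraMap K (ExteriorAlgebra K V) a ∈ ⋀[K]^0 V := by
    rw [ExteriorAlgebra.exteriorPower, pow_zero]; exact Submodule.mem_one.mpr ⟨a, rfl⟩
  have hd' : algebraMap K (ExteriorAlgebra K V) a ∈ ⋀[K]^d V := by
    rw [eq_neg_of_add_eq_zero_left h]; exact Submodule.neg_mem _ (Submodule.smul_mem _ b hω)
  have h00 := (disjoint_exteriorPower (K := K) (V := V) (Ne.symm hd)).le_bot ⟨h0, hd'⟩
  rw [Submodule.mem_bot, ExteriorAlgebra.algebraMap_eq_zero_iff] at h00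
  exact ha h00

/-- **Three subspaces in the degree windows `{2, 2n-2}`, `{1, 2n-1}`, `{0, 2n}` are independent** (`n ≥ 2`), by the
grading of `Λ V`. [cite: BourbakiAlgebre1a3, Ch. III §7 no. 1 (the grading is a direct sum)] -/
theorem iSupIndep_three_of_le_exteriorPower {n : ℕ} (hn : 2 ≤ n) {P₀ P₁ P₂ : Submodule K (ExteriorAlgebra K V)}
    (h₀ : P₀ ≤ ⋀[K]^0 V ⊔ ⋀[K]^(2 * n) V) (h₁ : P₁ ≤ ⋀[K]^1 V ⊔ ⋀[K]^(2 * n - 1) V)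
    (h₂ : P₂ ≤ ⋀[K]^2 V ⊔ ⋀[K]^(2 * n - 2) V) : iSupIndep ![P₂, P₁, P₀] ∧ iSupIndep ![P₀, P₁, P₂] := by
  have hG : iSupIndep (fun d : ℕ => ⋀[K]^d V) := (DirectSum.Decomposition.isInternal (fun d : ℕ => ⋀[K]^d V)).submodule_iSupIndep
  -- degree windows
  let D : Fin 3 → Set ℕ := ![{2, 2 * n - 2}, {1, 2 * n - 1}, {0, 2 * n}]
  have d01 : Disjoint ({2, 2 * n - 2} : Set ℕ) {1, 2 * n - 1} := by
    simp only [Set.disjoint_insert_left, Set.disjoint_singleton_left, Set.mem_insert_iff, Set.mem_singleton_iff]; omega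
  have d02 : Disjoint ({2, 2 * n - 2} : Set ℕ) {0, 2 * n} := by
    simp only [Set.disjoint_insert_left, Set.disjoint_singleton_left, Set.mem_insert_iff, Set.mem_singleton_iff]; omega
  have d12 : Disjoint ({1, 2 * n - 1} : Set ℕ) {0, 2 * n} := by
    simp only [Set.disjoint_insert_left, Set.disjoint_singleton_left, Set.mem_insert_iff, Set.mem_singleton_iff]; omega
  have hDdisj : ∀ i j, i ≠ j → Disjoint (D i) (D j) := by
    intro i j hij
    fin_cases i <;> fin_cases j
    exacts [absurd rfl hij, d01, d02, d01.symm, absurd rfl hij, d12, d02.symm, d12.symm, absurd rfl hij]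
  -- the windows are independent
  have hT : iSupIndep (fun i : Fin 3 => ⨆ d ∈ D i, ⋀[K]^d V) := by
    rw [iSupIndep_def]
    intro i
    refine (hG.disjoint_biSup_biSup (s := D i) (t := ⋃ j ∈ ({j | j ≠ i} : Set (Fin 3)), D j) ?_).mono_right ?_
    · rw [Set.disjoint_iUnion₂_right]
      exact fun j hj => hDdisj i j (Ne.symm hj)
    · exact iSup₂_le fun j hj => biSup_mono fun d hd => Set.mem_biUnion hj hd
  have hle : ∀ {P : Submodule K (ExteriorAlgebra K V)} {d d' : ℕ} (i : Fin 3), P ≤ ⋀[K]^d V ⊔ ⋀[K]^d' V → D i = {d, d'} →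
      P ≤ ⨆ e ∈ D i, ⋀[K]^e V := by
    intro P d d' i hP hDi
    rw [hDi]
    exact hP.trans (sup_le (le_iSup₂_of_le d (by simp) le_rfl) (le_iSup₂_of_le d' (by simp) le_rfl))
  refine ⟨hT.mono fun i => ?_, (hT.comp (f := ![(2 : Fin 3), 1, 0]) (by decide)).mono fun i => ?_⟩
  · fin_cases i
    exacts [hle 0 h₂ rfl, hle 1 h₁ rfl, hle 2 h₀ rfl]
  · fin_cases i
    exacts [hle 2 h₀ rfl, hle 1 h₁ rfl, hle 0 h₂ rfl]

variable {V₁ V₂ L₁ : Submodule K V}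

/-- The point-ideal class of the factor, pushed into `Λ V`, is `a·1 + b·Λι(ω)`. [cite: BourbakiAlgebre1a3, Ch. III §7 no. 2] -/
theorem map_algebraMap_add_smul (a b : K) (ω' : ExteriorAlgebra K V₁) :
    ExteriorAlgebra.map V₁.subtype (algebraMap K _ a + b • ω') =
      algebraMap K (ExteriorAlgebra K V) a + b • ExteriorAlgebra.map V₁.subtype ω' := by
  rw [map_add, AlgHom.commutes, map_smul]

/-- It is EVEN (lies in `Λ^{even} V₁`) when `ω` has even degree. [cite: BourbakiAlgebre1a3, Ch. III §7 no. 2] -/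
theorem map_algebraMap_add_smul_mem_evenFactorAlg (a b : K) {n : ℕ} {ω' : ExteriorAlgebra K V₁}
    (hω' : ω' ∈ ⋀[K]^(2 * n) V₁) : ExteriorAlgebra.map V₁.subtype (algebraMap K _ a + b • ω') ∈ evenFactorAlg V₁ := by
  rw [map_algebraMap_add_smul]
  refine Subalgebra.add_mem _ (Subalgebra.algebraMap_mem _ a) (Subalgebra.smul_mem _ ?_ b)
  have h := map_mem_evenFactorAlg V₁.subtype hω'
  rwa [Submodule.range_subtype] at h

/-- **Degrees and independence of the three factor spans** of `x₁ = a·1 + b·ω` (`ω` a top form of `V₁` of dimension `2n`,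
`n ≥ 2`): `S² ⊆ Λ² ⊕ Λ^{2n-2}`, `S¹ ⊆ Λ¹ ⊕ Λ^{2n-1}`, `K x₁ ⊆ Λ⁰ ⊕ Λ^{2n}`, hence both orderings are independent.
[cite: BourbakiAlgebre1a3, Ch. III §7 no. 1 and §11 no. 9] -/
theorem iSupIndep_spans_pointIdeal [FiniteDimensional K V] (hL₁ : L₁ ≤ V₁) {n : ℕ} (hn : 2 ≤ n)
    (hV₁ : Module.finrank K V₁ = 2 * n) {ω' : ExteriorAlgebra K V₁} (hω' : ω' ∈ ⋀[K]^(2 * n) V₁) {a b : K} (ha : a ≠ 0)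
    (hb : b ≠ 0) :
    iSupIndep ![span (L₁ : Set V) (factorForms L₁ V₂) (ExteriorAlgebra.map V₁.subtype (algebraMap K _ a + b • ω')),
        span₁ (L₁ : Set V) (factorForms L₁ V₂) (ExteriorAlgebra.map V₁.subtype (algebraMap K _ a + b • ω')),
        K ∙ ExteriorAlgebra.map V₁.subtype (algebraMap K _ a + b • ω')] ∧
      iSupIndep ![K ∙ ExteriorAlgebra.map V₁.subtype (algebraMap K _ a + b • ω'),
        span₁ (L₁ : Set V) (factorForms L₁ V₂) (ExteriorAlgebra.map V₁.subtype (algebraMap K _ a + b • ω')),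
        span (L₁ : Set V) (factorForms L₁ V₂) (ExteriorAlgebra.map V₁.subtype (algebraMap K _ a + b • ω'))] := by
  have hω : ExteriorAlgebra.map V₁.subtype ω' ∈ ⋀[K]^(2 * n) V := map_mem_exteriorPower _ hω'
  have hLω : ∀ q ∈ (L₁ : Set V), ι K q * ExteriorAlgebra.map V₁.subtype ω' = 0 := fun q hq => by
    rw [show ι K q = ExteriorAlgebra.map V₁.subtype (ι K ⟨q, hL₁ hq⟩) by rw [ExteriorAlgebra.map_apply_ι]; rfl, ← map_mul,
      ι_mul_eq_zero_of_mem_top hV₁ hω', map_zero]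
  have hΘL : ∀ θ ∈ factorForms L₁ V₂, ∀ q ∈ (L₁ : Set V), θ q = 0 := fun θ hθ q hq => hθ.1 q hq
  rw [map_algebraMap_add_smul]
  refine iSupIndep_three_of_le_exteriorPower hn ?_ ?_ ?_
  · refine (Submodule.span_singleton_le_iff_mem _ _).mpr (Submodule.add_mem _ (Submodule.mem_sup_left ?_)
      (Submodule.mem_sup_right (Submodule.smul_mem _ b hω)))
    rw [ExteriorAlgebra.exteriorPower, pow_zero]
    exact Submodule.mem_one.mpr ⟨a, rfl⟩
  · rw [span₁_algebraMap_add_smul hLω (Ne.isUnit ha) (Ne.isUnit hb)]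
    exact sup_le_sup (vecBlock_le _) (contractBlock₁_le _ hω)
  · rw [span_algebraMap_add_smul hΘL hLω (Ne.isUnit ha) (Ne.isUnit hb)]
    exact sup_le_sup (wedgeBlock_le _) (contractBlock_le _ hω)

/-- `dim K x₁ = 1`. [cite: BourbakiAlgebre1a3, Ch. III §7 no. 1] -/
theorem finrank_span_singleton_pointIdeal {n : ℕ} (hn : n ≠ 0) {ω' : ExteriorAlgebra K V₁} (hω' : ω' ∈ ⋀[K]^(2 * n) V₁)
    {a : K} (ha : a ≠ 0) (b : K) :
    Module.finrank K (K ∙ ExteriorAlgebra.map V₁.subtype (algebraMap K _ a + b • ω')) = 1 := by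
  rw [map_algebraMap_add_smul]
  exact finrank_span_singleton (algebraMap_add_smul_ne_zero ha b (by omega) (map_mem_exteriorPower _ hω'))

/-- `dim S¹(x₁) = 2n` inside `Λ V` (transported `finrank_span₁_pointIdeal`). [cite: BourbakiAlgebre1a3, Ch. III §11 no. 9] -/
theorem finrank_span₁_pointIdeal_map [FiniteDimensional K V] (hV : IsCompl V₁ V₂) (hL₁ : L₁ ≤ V₁) {n : ℕ} (hn : 2 ≤ n)
    (hV₁ : Module.finrank K V₁ = 2 * n) (hl₁ : Module.finrank K L₁ = n) {ω' : ExteriorAlgebra K V₁}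
    (hω' : ω' ∈ ⋀[K]^(2 * n) V₁) (hω'0 : ω' ≠ 0) {a b : K} (ha : a ≠ 0) (hb : b ≠ 0) :
    Module.finrank K (span₁ (L₁ : Set V) (factorForms L₁ V₂) (ExteriorAlgebra.map V₁.subtype (algebraMap K _ a + b • ω'))) =
      2 * n := by
  rw [finrank_span₁_map_eq hV hL₁]
  exact finrank_span₁_pointIdeal hV₁ _ ((Submodule.comapSubtypeEquivOfLe hL₁).finrank_eq.trans hl₁) hω' hω'0 ha hb hn

/-- `dim S²(x₁) = 2·C(n, 2)` inside `Λ V` for `n ≥ 3` (transported T_lin). [cite: BourbakiAlgebre1a3, Ch. III §11 no. 9] -/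
theorem finrank_span_pointIdeal_map [FiniteDimensional K V] (hV : IsCompl V₁ V₂) (hL₁ : L₁ ≤ V₁) {n : ℕ} (hn : 3 ≤ n)
    (hV₁ : Module.finrank K V₁ = 2 * n) (hl₁ : Module.finrank K L₁ = n) {ω' : ExteriorAlgebra K V₁}
    (hω' : ω' ∈ ⋀[K]^(2 * n) V₁) (hω'0 : ω' ≠ 0) {a b : K} (ha : a ≠ 0) (hb : b ≠ 0) :
    Module.finrank K (span (L₁ : Set V) (factorForms L₁ V₂) (ExteriorAlgebra.map V₁.subtype (algebraMap K _ a + b • ω'))) =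
      2 * n.choose 2 := by
  rw [finrank_span_map_eq hV hL₁]
  exact finrank_span_pointIdeal hV₁ _ ((Submodule.comapSubtypeEquivOfLe hL₁).finrank_eq.trans hl₁) hω' hω'0 ha hb hn

/-- `dim S²(x₁) = 1` inside `Λ V` for `n = 2` (transported `finrank_span_pointIdeal_two`). [cite: BourbakiAlgebre1a3, Ch. III §11 no. 9] -/
theorem finrank_span_pointIdeal_map_two [FiniteDimensional K V] (hV : IsCompl V₁ V₂) (hL₁ : L₁ ≤ V₁)
    (hV₁ : Module.finrank K V₁ = 4) (hl₁ : Module.finrank K L₁ = 2) {ω' : ExteriorAlgebra K V₁} (hω' : ω' ∈ ⋀[K]^4 V₁)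
    {a b : K} (ha : a ≠ 0) (hb : b ≠ 0) :
    Module.finrank K (span (L₁ : Set V) (factorForms L₁ V₂) (ExteriorAlgebra.map V₁.subtype (algebraMap K _ a + b • ω'))) =
      1 := by
  rw [finrank_span_map_eq hV hL₁]
  exact finrank_span_pointIdeal_two hV₁ _ ((Submodule.comapSubtypeEquivOfLe hL₁).finrank_eq.trans hl₁) hω' ha hb

end Factor

/-! ### 3. The point-pair box -/

section Box

variable {K : Type*} [Field K] {V : Type*} [AddCommGroup V] [Module K V] [FiniteDimensional K V]
  {V₁ V₂ L₁ L₂ : Submodule K V}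

/-- **THE POINT-PAIR BOX, `n ≥ 3` (th-7 FORMULA-N §N.3: `r₂·1 + r₁·r₁ + 1·r₂ = [t²]P_n²`).** Over a splitting
`V = V₁ ⊕ V₂` into two `2n`-dimensional factors with `n`-dimensional `Lᵢ ⊆ Vᵢ`, for top forms `ωᵢ ≠ 0` of the factors and
`aᵢ, bᵢ ≠ 0`, the contraction span of the product class `(a₁ + b₁ω₁) ∧ (a₂ + b₂ω₂)` (the shape of `ch(I_p ⊠ I_q)` on `X × X′`)
with respect to `(L₁ ⊕ L₂, (L₁ ⊕ L₂)^⊥)` has dimension `2·C(n,2)·1 + 2n·2n + 1·2·C(n,2)`.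
[cite: BourbakiAlgebre1a3, Ch. III §7 no. 7 and §11 no. 9] -/
theorem finrank_span_pointPairBox (hV : IsCompl V₁ V₂) {n : ℕ} (hn : 3 ≤ n) (hV₁ : Module.finrank K V₁ = 2 * n)
    (hV₂ : Module.finrank K V₂ = 2 * n) (hL₁ : L₁ ≤ V₁) (hL₂ : L₂ ≤ V₂) (hl₁ : Module.finrank K L₁ = n)
    (hl₂ : Module.finrank K L₂ = n) {ω₁ : ExteriorAlgebra K V₁} (hω₁ : ω₁ ∈ ⋀[K]^(2 * n) V₁) (hω₁0 : ω₁ ≠ 0)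
    {ω₂ : ExteriorAlgebra K V₂} (hω₂ : ω₂ ∈ ⋀[K]^(2 * n) V₂) (hω₂0 : ω₂ ≠ 0) {a₁ b₁ a₂ b₂ : K} (ha₁ : a₁ ≠ 0)
    (hb₁ : b₁ ≠ 0) (ha₂ : a₂ ≠ 0) (hb₂ : b₂ ≠ 0) :
    Module.finrank K (span ((L₁ ⊔ L₂ : Submodule K V) : Set V) {θ : Module.Dual K V | ∀ q ∈ L₁ ⊔ L₂, θ q = 0}
      (ExteriorAlgebra.map V₁.subtype (algebraMap K _ a₁ + b₁ • ω₁) *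
        ExteriorAlgebra.map V₂.subtype (algebraMap K _ a₂ + b₂ • ω₂))) =
      2 * n.choose 2 * 1 + 2 * n * (2 * n) + 1 * (2 * n.choose 2) := by
  have hn2 : 2 ≤ n := by omega
  rw [finrank_span_mul_eq hV hL₁ hL₂ (map_algebraMap_add_smul_mem_evenFactorAlg a₁ b₁ hω₁)
      (map_algebraMap_add_smul_mem_evenFactorAlg a₂ b₂ hω₂) (iSupIndep_spans_pointIdeal hL₁ hn2 hV₁ hω₁ ha₁ hb₁).1
      (iSupIndep_spans_pointIdeal (V₂ := V₁) hL₂ hn2 hV₂ hω₂ ha₂ hb₂).2,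
    finrank_span_pointIdeal_map hV hL₁ hn hV₁ hl₁ hω₁ hω₁0 ha₁ hb₁,
    finrank_span_singleton_pointIdeal (by omega) hω₂ ha₂,
    finrank_span₁_pointIdeal_map hV hL₁ hn2 hV₁ hl₁ hω₁ hω₁0 ha₁ hb₁,
    finrank_span₁_pointIdeal_map hV.symm hL₂ hn2 hV₂ hl₂ hω₂ hω₂0 ha₂ hb₂,
    finrank_span_singleton_pointIdeal (by omega) hω₁ ha₁,
    finrank_span_pointIdeal_map hV.symm hL₂ hn hV₂ hl₂ hω₂ hω₂0 ha₂ hb₂]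

/-- `4·C(n, 2) + 4n² = 6n² - 2n`. [folklore] -/
theorem two_mul_choose_two_box (n : ℕ) : 2 * n.choose 2 * 1 + 2 * n * (2 * n) + 1 * (2 * n.choose 2) = 6 * n ^ 2 - 2 * n := by
  have h : n.choose 2 * 2 = n * (n - 1) := by
    rw [Nat.choose_two_right, Nat.div_mul_cancel (Nat.even_mul_pred_self n).two_dvd]
  rcases Nat.eq_zero_or_pos n with rfl | hn
  · simp
  · have hn1 : 1 ≤ n := hn
    have h2 : 2 * n ≤ 6 * n ^ 2 := by nlinarith
    have h3 : 2 * n.choose 2 * 1 + 2 * n * (2 * n) + 1 * (2 * n.choose 2) = 2 * (n.choose 2 * 2) + 4 * n ^ 2 := by ring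
    rw [h3, h]
    zify [h2, hn1]
    ring

/-- **THE POINT-PAIR BOX, `n ≥ 3`, closed form: `dim = 6n² - 2n`** (`48` at `n = 3`, the census' `r` on the split
sixfold anchors). [cite: BourbakiAlgebre1a3, Ch. III §7 no. 7 and §11 no. 9] -/
theorem finrank_span_pointPairBox' (hV : IsCompl V₁ V₂) {n : ℕ} (hn : 3 ≤ n) (hV₁ : Module.finrank K V₁ = 2 * n)
    (hV₂ : Module.finrank K V₂ = 2 * n) (hL₁ : L₁ ≤ V₁) (hL₂ : L₂ ≤ V₂) (hl₁ : Module.finrank K L₁ = n)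
    (hl₂ : Module.finrank K L₂ = n) {ω₁ : ExteriorAlgebra K V₁} (hω₁ : ω₁ ∈ ⋀[K]^(2 * n) V₁) (hω₁0 : ω₁ ≠ 0)
    {ω₂ : ExteriorAlgebra K V₂} (hω₂ : ω₂ ∈ ⋀[K]^(2 * n) V₂) (hω₂0 : ω₂ ≠ 0) {a₁ b₁ a₂ b₂ : K} (ha₁ : a₁ ≠ 0)
    (hb₁ : b₁ ≠ 0) (ha₂ : a₂ ≠ 0) (hb₂ : b₂ ≠ 0) :
    Module.finrank K (span ((L₁ ⊔ L₂ : Submodule K V) : Set V) {θ : Module.Dual K V | ∀ q ∈ L₁ ⊔ L₂, θ q = 0}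
      (ExteriorAlgebra.map V₁.subtype (algebraMap K _ a₁ + b₁ • ω₁) *
        ExteriorAlgebra.map V₂.subtype (algebraMap K _ a₂ + b₂ • ω₂))) = 6 * n ^ 2 - 2 * n := by
  rw [finrank_span_pointPairBox hV hn hV₁ hV₂ hL₁ hL₂ hl₁ hl₂ hω₁ hω₁0 hω₂ hω₂0 ha₁ hb₁ ha₂ hb₂, two_mul_choose_two_box]

/-- **THE POINT-PAIR BOX, `n = 2`: `dim = 1·1 + 4·4 + 1·1 = 18`** — the census' `r = 18` at `g = 4` (`X × X̂`, `X` an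
abelian surface) as a theorem of the class shape. [cite: BourbakiAlgebre1a3, Ch. III §7 no. 7 and §11 no. 9] -/
theorem finrank_span_pointPairBox_two (hV : IsCompl V₁ V₂) (hV₁ : Module.finrank K V₁ = 4)
    (hV₂ : Module.finrank K V₂ = 4) (hL₁ : L₁ ≤ V₁) (hL₂ : L₂ ≤ V₂) (hl₁ : Module.finrank K L₁ = 2)
    (hl₂ : Module.finrank K L₂ = 2) {ω₁ : ExteriorAlgebra K V₁} (hω₁ : ω₁ ∈ ⋀[K]^4 V₁) (hω₁0 : ω₁ ≠ 0)
    {ω₂ : ExteriorAlgebra K V₂} (hω₂ : ω₂ ∈ ⋀[K]^4 V₂) (hω₂0 : ω₂ ≠ 0) {a₁ b₁ a₂ b₂ : K} (ha₁ : a₁ ≠ 0)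
    (hb₁ : b₁ ≠ 0) (ha₂ : a₂ ≠ 0) (hb₂ : b₂ ≠ 0) :
    Module.finrank K (span ((L₁ ⊔ L₂ : Submodule K V) : Set V) {θ : Module.Dual K V | ∀ q ∈ L₁ ⊔ L₂, θ q = 0}
      (ExteriorAlgebra.map V₁.subtype (algebraMap K _ a₁ + b₁ • ω₁) *
        ExteriorAlgebra.map V₂.subtype (algebraMap K _ a₂ + b₂ • ω₂))) = 18 := by
  have hω₁' : ω₁ ∈ ⋀[K]^(2 * 2) V₁ := hω₁
  have hω₂' : ω₂ ∈ ⋀[K]^(2 * 2) V₂ := hω₂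
  rw [finrank_span_mul_eq hV hL₁ hL₂ (map_algebraMap_add_smul_mem_evenFactorAlg a₁ b₁ hω₁')
      (map_algebraMap_add_smul_mem_evenFactorAlg a₂ b₂ hω₂') (iSupIndep_spans_pointIdeal hL₁ le_rfl hV₁ hω₁' ha₁ hb₁).1
      (iSupIndep_spans_pointIdeal (V₂ := V₁) hL₂ le_rfl hV₂ hω₂' ha₂ hb₂).2,
    finrank_span_pointIdeal_map_two hV hL₁ hV₁ hl₁ hω₁ ha₁ hb₁,
    finrank_span_singleton_pointIdeal (n := 2) (by omega) hω₂' ha₂,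
    finrank_span₁_pointIdeal_map hV hL₁ le_rfl hV₁ hl₁ hω₁' hω₁0 ha₁ hb₁,
    finrank_span₁_pointIdeal_map hV.symm hL₂ le_rfl hV₂ hl₂ hω₂' hω₂0 ha₂ hb₂,
    finrank_span_singleton_pointIdeal (n := 2) (by omega) hω₁' ha₁,
    finrank_span_pointIdeal_map_two hV.symm hL₂ hV₂ hl₂ hω₂ ha₂ hb₂]

end Box

end ContractionSpan

end Summit.Ventures.HSemireg

end
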